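import Mathlib
import Summits.NavierStokesRegularity.NavierStokesRegularity.Theorems.SubOnsagerCeilingVirtualFloorWindow4Face
import HarnessLib

/-!
# Quadratic face families for the Ω-coupled general-face scheme: continuity and the chain rule, discharged once
(helper file for crux stmt-NavierStokesRegularity-27057 `SubOnsagerCeiling.ForwardTailCeilingKP`, `--supports … --as helper`;
LEAD SOC g9, line «kp-shell-barrier»)

`window4_le_of_coupledFaceCertB` / `chain_le_of_coupledFaceCertB` (LEAD g9) take an arbitrary finite face family `g k` with
partial derivatives `dg k i`, continuity (`hcontg`) and a right-sided chain rule (`hchain`) as hypotheses. For the designs the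
line needs (LEAD g8 census v11 §I.8: faces curved in `(x₁, x₂)` in the sliver `x₁ ≈ c`; planes and caps elsewhere) QUADRATIC faces
suffice: `g x = Σᵢⱼ Q i j xᵢxⱼ + Σᵢ l i xᵢ + c₀` (planes: `Q = 0`). This file defines that family (`quadFace`, gradient
`quadFaceGrad`) and proves `hcontg` and `hchain` for it once and for all (`quadFace_continuous`, `quadFace_hasDerivWithinAt`), so a
rung instance supplies only NUMBERS and the per-face kernel certificates (`SubOnsagerCeilingVirtualFloorKernelFace{,Coupled}`,
p687184 / p687873). MODEL lattice; no certificate is proved here; nothing here bears on Navier–Stokes regularity; 27057 stays OPEN.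
[cite: BarbatoMorandinRomito2011, §2 Lemma 2.1 (the faces of an invariant region)]
-/

noncomputable section

-- the sub-problem namespace `NavierStokesRegularity.NavierStokesRegularity` is the tree's layout (D-0017)
set_option linter.dupNamespace false

namespace Summit.NavierStokesRegularity.NavierStokesRegularity.Theorems.VirtualFloor

open Set Filter Topology

/-- A quadratic face `g x = Σᵢ Σⱼ Q i j · xᵢ xⱼ + Σᵢ l i · xᵢ + c₀` on four-shell windows (planes: `Q = 0`). [folklore] -/
def quadFace (Q : Fin 4 → Fin 4 → ℝ) (l : Fin 4 → ℝ) (c₀ : ℝ) (x : Fin 4 → ℝ) : ℝ :=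
  (∑ i, ∑ j, Q i j * x i * x j) + (∑ i, l i * x i) + c₀

/-- Its partial derivatives: `∂ᵢ g x = Σⱼ (Q i j + Q j i) xⱼ + l i`. [folklore] -/
def quadFaceGrad (Q : Fin 4 → Fin 4 → ℝ) (l : Fin 4 → ℝ) (i : Fin 4) (x : Fin 4 → ℝ) : ℝ :=
  (∑ j, (Q i j + Q j i) * x j) + l i

/-- A quadratic face is continuous (hypothesis `hcontg` of `window4_le_of_coupledFaceCertB`). [folklore] -/
theorem quadFace_continuous (Q : Fin 4 → Fin 4 → ℝ) (l : Fin 4 → ℝ) (c₀ : ℝ) : Continuous (quadFace Q l c₀) := by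
  unfold quadFace
  refine ((continuous_finsetSum _ fun i _ => continuous_finsetSum _ fun j _ => ?_).add
    (continuous_finsetSum _ fun i _ => ?_)).add continuous_const
  · exact ((continuous_const.mul (continuous_apply i)).mul (continuous_apply j))
  · exact continuous_const.mul (continuous_apply i)

/-- **The right-sided chain rule for a quadratic face** along any curve with componentwise derivatives (hypothesis `hchain`
of `window4_le_of_coupledFaceCertB` / `chain_le_of_coupledFaceCertB`). [folklore] -/
theorem quadFace_hasDerivWithinAt (Q : Fin 4 → Fin 4 → ℝ) (l : Fin 4 → ℝ) (c₀ : ℝ)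
    (X : ℝ → Fin 4 → ℝ) (X' : Fin 4 → ℝ) (S : Set ℝ) (t : ℝ)
    (hX : ∀ i, HasDerivWithinAt (fun r => X r i) (X' i) S t) :
    HasDerivWithinAt (fun r => quadFace Q l c₀ (X r)) (∑ i, quadFaceGrad Q l i (X t) * X' i) S t := by
  have hq : HasDerivWithinAt (fun r => ∑ i, ∑ j, Q i j * X r i * X r j)
      (∑ i, ∑ j, Q i j * (X' i * X t j + X t i * X' j)) S t := by
    refine HasDerivWithinAt.fun_sum fun i _ => HasDerivWithinAt.fun_sum fun j _ => ?_
    have h1 : HasDerivWithinAt (fun r => X r i * X r j) (X' i * X t j + X t i * X' j) S t := (hX i).mul (hX j)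
    have h2 := h1.const_mul (Q i j)
    have hfun : (fun r => Q i j * X r i * X r j) = fun r => Q i j * (X r i * X r j) := by funext r; ring
    rw [hfun]
    exact h2
  have hl : HasDerivWithinAt (fun r => ∑ i, l i * X r i) (∑ i, l i * X' i) S t :=
    HasDerivWithinAt.fun_sum fun i _ => (hX i).const_mul (l i)
  have h := (hq.add hl).add_const c₀
  have hfun : (fun r => quadFace Q l c₀ (X r)) = fun r => (∑ i, ∑ j, Q i j * X r i * X r j) + (∑ i, l i * X r i) + c₀ := by
    funext r; rfl
  rw [hfun]
  refine h.congr_deriv ?_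
  simp only [quadFaceGrad, Fin.sum_univ_four]
  ring

end Summit.NavierStokesRegularity.NavierStokesRegularity.Theorems.VirtualFloor

end
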